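import Summits.HodgeConjecture.HodgeConjecture.Theorems.Ring2AbelianAllStandardAPencils
import HarnessLib

/-!
# Ring 2 · §AbelianAll (seat `ab-andre-1`), XIV-c — the `A`-ladder's low rungs, FACT-FREE: Grothendieck's `A(X, η)`
# for every smooth complex projective `X` of dimension `≤ 4` (clause (b) is the identity in the middle codimension and
# Lefschetz `(1,1)` in codimension `1`), hence `(A∀)_d`, `(A^CM)_d` for every `d ≤ 3`; the first open `A`-rung is
# `d = 4`, isolated as ONE surjectivity `L_η : N² H⁴(𝒳) ↠ N³ H⁶(𝒳)` on fivefold total spaces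

HONEST FRAMING: research route, not a corollary; conditional on HC_CM plus one named minimal statement.
(Cell line: research route conditional on HC_CM; not a corollary; Q11.4-sentence-2 already refuted in dim ≥ 3.)

Cell `pub-hodge-ring2`, sub-cell `pub-hodge-ring2-ab-*` (ALL ABELIAN VARIETIES), seat `ab-andre-1`, gen 27; sequel to
parts XIV (`Ring2AbelianAllStandardAPencils`: the nodes `CompactAbelianPencilStandardA` = A_pen∀,
`CMPointedPencilStandardA` = A_pen^CM, graded `StandardACompactPencilsAtRelDim d`, `StandardACMPointedPencilsAtRelDim d`)
and XIV-b (`Ring2AbelianAllStandardAPencilsTransport`: the transport rows on the `A`-node). `HC_CM` =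
`Theses.RankFourFaces.CMAbelianHodge` (stmt-HodgeConjecture-3052), a BINDER; `HC_AV` =
`Theses.PadicSemiregularLift.HodgeAbelianVarieties` (stmt-1333); the item `Theses.RankFourFaces.CMToAbelian` (stmt-16267)
is OPEN and NOT closed here. Nothing below proves a case of the Hodge conjecture beyond what the tree already has
(codimension `0`, `algebraicClasses_zero`; codimension `1`, the Lefschetz theorem on `(1,1)`-classes
`lefschetzOneOne_rational_holds`); NO named fact is used; no new definition is made (theorems only).

## Why this part exists

Part XIV §C certified the rungs `d ≤ 2` of the `A`-ladder through the tree theorem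
`standardConjectureA_of_dim_le_three` (the Hodge conjecture in dimension `≤ 3`), and its docstrings describe the rung
`d = 3` (compact pencils of abelian THREEFOLDS, fourfold total spaces) as open "in both forms". For the `A`-form that
is too pessimistic. In the tree's spelling `StandardConjectureA n X η` (file `HodgeTheory/MotivatedClasses`; Grothendieck,
Bombay 1968, §3 p. 196), clause (b) asks, for `2p + r = n` and `p + r = q`, that `Lʳ = (η ∪ ·)ʳ` map `Nᵖ H²ᵖ(X(ℂ); ℂ)`
bijectively onto `N^q H^{2p+2r}`. Three remarks, all classical and all kernel-checked below on the real carriers: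

* `r = 0` (the MIDDLE codimension, `2p = n`): `L⁰ = id` and source = target, so the clause is EMPTY — Grothendieck's
  `A(X)` never constrains the middle-dimensional cycles (that is the business of `D(X)` / `B(X)`);
* `p = 0`: `N⁰ H⁰ = H⁰` (`algebraicClasses_zero`), so "onto" is hard Lefschetz;
* `p = 1`: every class of `N^q H^{2n-2}` is a Hodge class, hence `Lⁿ⁻²` of a rational `(1,1)`-class (hard Lefschetz over
  `ℚ`, bidegree `(n-2, n-2)`: the tree's `lefschetzPow_surjOn_algebraicClasses_of_hodgeClasses_algebraic`), which is
  algebraic by Lefschetz `(1,1)` (the tree THEOREM `lefschetzOneOne_rational_holds`, Voisin I Thm. 11.30).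

Hence the only content of `A(X, η)` sits in the codimensions `2 ≤ p < n/2`, which do not exist for `n ≤ 4`: **`A(X, η)`
holds for every smooth complex projective `X` of dimension `≤ 4` and every polarisation class** — consistent with the
classical status of `D(X)` (`⇔ A(X, L)` in characteristic `0`), known for `dim X ≤ 4` and for abelian varieties by the
work of Kleiman and Lieberman (Lieberman 1968; Kleiman 1968, 1994). For the pencil ladders of this cell: the `A`-rung
`d = 3` is a THEOREM (no fact), whereas on the `B`-ladder (`⋆_L`-form, parts I/VII/IX/X) `d = 2` needs Tankeev 2011 and
`d = 3` is open; and the first open `A`-rung, `d = 4` (compact pencils of abelian FOURFOLDS — the habitat of Weil-type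
fibres — with FIVEFOLD total spaces), is exactly one surjectivity: `L_η : N² H⁴(𝒳(ℂ); ℂ) ↠ N³ H⁶(𝒳(ℂ); ℂ)`.

## What is PROVED here (kernel-checked, sorry-free, fact-free)

* §1 (real carriers, any `X`): `standardConjectureA_of_surjOn` — `A(X, η)` follows from the "onto" half of clause (b) in
  the range `r > 0` alone (into: `lefschetzPow_mapsTo_algebraicClasses`; injective: hard Lefschetz; `r = 0`: identity);
  `bijOn_lefschetzPow_algebraicClasses_one` — clause (b) for `p = 1` UNCONDITIONALLY (Lefschetz `(1,1)`);
  `standardConjectureA_of_surjOn_two_le` — `A(X, η)` from the "onto" half in the codimensions `2 ≤ p`, `2p < n` only;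
  `standardConjectureA_of_hodgeClasses_algebraic_below_middle` — `A(X, η)` from the Hodge conjecture for `X` in the
  codimensions `2p < n` (refines the tree's `standardConjectureA_of_hodgeClasses_algebraic`, which asks `2p ≤ n`);
  **`standardConjectureA_of_dim_le_four`** — `A(X, η)` for `n ≤ 4`, every polarisation class, unconditionally;
  `standardConjectureA_five_iff_surjOn` — for `n = 5`, `A(X, η) ⟺ L_η(N² H⁴) ⊇ N³ H⁶`.
* §2 (the ladders of part XIV): `standardACompactPencilsAtRelDim_of_le_three`, `standardACMPointedPencilsAtRelDim_of_le_three`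
  (rungs `d ≤ 3` fact-free), `compactAbelianPencilStandardA_iff_forall_four_le`, `cmPointedPencilStandardA_iff_forall_four_le`
  (A_pen∀ / A_pen^CM are equivalent to their pieces of relative dimension `≥ 4`), and
  `standardACompactPencilsAtRelDim_four_iff_surjOn` (the first open rung as one surjectivity per pencil and polarisation).

## What is NOT claimed

No rung `d ≥ 4` and no case of `B(𝒳)` is proved; `A_pen^CM` is not claimed minimal, nor strictly weaker than (5); the
`B`-ladder's rung `d = 3` stays open and its rung `d = 2` stays on Tankeev's fact (part X). ERRATUM to the docstrings of
part XIV (`CompactAbelianPencilStandardA`, `CMPointedPencilStandardA`, §C; statements unchanged): "OPEN for `d ≥ 3`" /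
"the rung `d = 3` … is open in both forms" should read "open for `d ≥ 4` in the `A`-form (`d ≤ 3` proved in part XIV-c);
`d = 3` open in the `⋆_L`-form". André 2026 is cited as a preprint (arXiv:2601.21052 v2; venue unverified).

## References

* [Grothendieck1968] A. Grothendieck, Standard conjectures on algebraic cycles (Bombay 1968), §3 p. 196 (`A(X)`).
* [Kleiman1968AlgebraicCycles] S. Kleiman, Algebraic cycles and the Weil conjectures (1968), §2–§3.
* [Kleiman1994StandardConjectures] S. Kleiman, The standard conjectures, in Motives (Seattle 1991), PSPM 55.1 (1994).
* [Lieberman1968] D. I. Lieberman, Numerical and homological equivalence of algebraic cycles on Hodge manifolds,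
  Amer. J. Math. 90 (1968) (`D(X)` for `dim X ≤ 4` and for abelian varieties, characteristic `0`).
* [VoisinHodgeI2002] C. Voisin, Hodge Theory and Complex Algebraic Geometry I (2002), Thm. 6.25, Rem. 6.27, §7.1.2,
  Thm. 11.30.
* [Andre1996Motifs] Y. André, Publ. Math. IHÉS 83 (1996), §6.3 Lemme 6.3.1, Remarque 2 (pp. 31–33).
* Y. André, Non-abelian Rees construction and pure motives, arXiv:2601.21052 (2026, preprint), §4.4.1.
-/

noncomputable section

set_option linter.dupNamespace false

namespace Summit.HodgeConjecture.HodgeConjecture.Ring2.AbelianAll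

open CategoryTheory AlgebraicGeometry
open Literature.AlgebraicGeometry Literature.AlgebraicGeometry.Motives
open Literature.AlgebraicGeometry.HodgeTheory
open Literature.AlgebraicTopology.SingularHomology Literature.Geometry.Kaehler
open Literature.AlgebraicGeometry.Deligne1982 (cmLocus)
open Summit.HodgeConjecture.HodgeConjecture

/-! ## §1 `A(X, η)` on the real carriers: the middle codimension is empty, codimension `1` is Lefschetz `(1,1)` -/

section RealCarriers

variable {n : ℕ} {X : SchemeOver ℂ} {η : complexBetti X 2}

/-- **Clause (b) of `A(X, η)` in the middle codimension is trivial**: for `r = 0`, `L⁰ = id` maps `Nᵖ H²ᵖ` bijectively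
onto `N^{p+0} H^{2p+0} = Nᵖ H²ᵖ` (definitional unfolding of `lefschetzPow`; no hypothesis on `X` or `η`).
[cite: Grothendieck1968, §3 p. 196 (A(X))] -/
theorem bijOn_lefschetzPow_zero_algebraicClasses (η : complexBetti X 2) (p : ℕ) :
    Set.BijOn (lefschetzPow η 0 (2 * p)) (algebraicClasses X p : Set (complexBetti X (2 * p)))
      (supportedClasses X (2 * p + 2 * 0) (p + 0)) :=
  ⟨fun _ hx ↦ hx, fun _ _ _ _ h ↦ h, fun y hy ↦ ⟨y, hy, rfl⟩⟩

/-- **`A(X, η)` from the surjectivity half of clause (b) in the range `r > 0` alone**: for `X` smooth projective of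
dimension `n` and `η` a polarisation class, clause (a) is the hard Lefschetz property of `η`; in clause (b), "into" is
unconditional (`lefschetzPow_mapsTo_algebraicClasses`, Voisin II Prop. 9.20), "injective" is hard Lefschetz on all of
`H²ᵖ`, and the case `r = 0` is the identity (`bijOn_lefschetzPow_zero_algebraicClasses`); so only "onto" for `r > 0`
has content ("an isomorphism (or equivalently, an epimorphism)", Grothendieck loc. cit.).
[cite: Grothendieck1968, §3 p. 196 (A(X))] [cite: VoisinHodgeII2003, §9.2.4 Prop. 9.20] -/
theorem standardConjectureA_of_surjOn (hX : IsSmoothProjective n X) (hη : IsPolarizationClass n X η)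
    (h : ∀ p r q : ℕ, 2 * p + r = n → p + r = q → 0 < r →
      Set.SurjOn (lefschetzPow η r (2 * p)) (algebraicClasses X p : Set (complexBetti X (2 * p)))
        (supportedClasses X (2 * p + 2 * r) q)) :
    StandardConjectureA n X η := by
  refine ⟨hη.hasHardLefschetz, fun p r q hpr hq ↦ ?_⟩
  obtain rfl | hr := Nat.eq_zero_or_pos r
  · subst hq
    exact bijOn_lefschetzPow_zero_algebraicClasses η p
  · exact ⟨lefschetzPow_mapsTo_algebraicClasses hX hη.mem_algebraicClasses hq,
      (hη.hasHardLefschetz r (2 * p) hpr).1.injOn, h p r q hpr hq hr⟩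

/-- **Clause (b) of `A(X, η)` in codimension `1` holds UNCONDITIONALLY, in every dimension**: for `X` smooth
projective of dimension `n = 2 + r` and `η` a polarisation class, `Lʳ : N¹ H²(X(ℂ); ℂ) → N^{1+r} H^{2n-2}(X(ℂ); ℂ)` is a
bijection — onto because every class of `N^{1+r} H^{2n-2}` is `Lʳ` of a rational `(1,1)`-class (hard Lefschetz over
`ℚ`, bidegree `(r, r)`: `lefschetzPow_surjOn_algebraicClasses_of_hodgeClasses_algebraic`), which is algebraic by the
Lefschetz theorem on `(1,1)`-classes (`lefschetzOneOne_rational_holds`).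
[cite: VoisinHodgeI2002, Thm. 11.30, Thm. 6.25, Rem. 6.27 and §7.1.2] [cite: Grothendieck1968, §3 p. 196 (A(X))] -/
theorem bijOn_lefschetzPow_algebraicClasses_one (hX : IsSmoothProjective n X) (hη : IsPolarizationClass n X η)
    {r q : ℕ} (hr : 2 * 1 + r = n) (hq : 1 + r = q) :
    Set.BijOn (lefschetzPow η r (2 * 1)) (algebraicClasses X 1 : Set (complexBetti X (2 * 1)))
      (supportedClasses X (2 * 1 + 2 * r) q) :=
  ⟨lefschetzPow_mapsTo_algebraicClasses hX hη.mem_algebraicClasses hq,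
    (hη.hasHardLefschetz r (2 * 1) hr).1.injOn,
    lefschetzPow_surjOn_algebraicClasses_of_hodgeClasses_algebraic hX hη hr hq
      fun c hc hpp ↦ lefschetzOneOne_rational_holds hX c hc hpp⟩

/-- **`A(X, η)` from the surjectivity half of clause (b) in the codimensions `2 ≤ p`, `2p < n` ONLY**: the
codimensions `p = 0` (`N⁰ H⁰ = H⁰`, `algebraicClasses_zero`) and `p = 1` (Lefschetz `(1,1)`,
`bijOn_lefschetzPow_algebraicClasses_one`) are unconditional, the middle one is empty (`standardConjectureA_of_surjOn`).
[cite: Grothendieck1968, §3 p. 196 (A(X))] [cite: VoisinHodgeI2002, Thm. 11.30, Thm. 6.25 and §7.1.2] -/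
theorem standardConjectureA_of_surjOn_two_le (hX : IsSmoothProjective n X) (hη : IsPolarizationClass n X η)
    (h : ∀ p r q : ℕ, 2 ≤ p → 2 * p + r = n → p + r = q → 0 < r →
      Set.SurjOn (lefschetzPow η r (2 * p)) (algebraicClasses X p : Set (complexBetti X (2 * p)))
        (supportedClasses X (2 * p + 2 * r) q)) :
    StandardConjectureA n X η := by
  refine standardConjectureA_of_surjOn hX hη fun p r q hpr hq hr ↦ ?_
  rcases Nat.lt_or_ge p 2 with hp | hp
  · -- `p ≤ 1`: the Hodge conjecture for `X` in codimension `p` is a theorem of the tree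
    refine lefschetzPow_surjOn_algebraicClasses_of_hodgeClasses_algebraic hX hη hpr hq fun c hc hpp ↦ ?_
    interval_cases p
    · simp [algebraicClasses_zero]
    · exact lefschetzOneOne_rational_holds hX c hc hpp
  · exact h p r q hp hpr hq hr

/-- **The Hodge conjecture for `X` in the codimensions `2p < n` implies `A(X, η)` for every polarisation class**
(refines the tree's `standardConjectureA_of_hodgeClasses_algebraic`, which asks it for `2p ≤ n`: the middle codimension
is not needed, clause (b) being the identity there). [cite: Grothendieck1968, §3 p. 196 (A(X))]
[cite: VoisinHodgeI2002, Thm. 6.25, Rem. 6.27 and §7.1.2] -/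
theorem standardConjectureA_of_hodgeClasses_algebraic_below_middle (hX : IsSmoothProjective n X)
    (hη : IsPolarizationClass n X η)
    (hHC : ∀ p : ℕ, 2 * p < n → ∀ c : complexBetti X (2 * p), IsRationalClass c →
      IsOfHodgeType n X (2 * p) p p c → c ∈ algebraicClasses X p) :
    StandardConjectureA n X η :=
  standardConjectureA_of_surjOn hX hη fun p _ _ hpr hq hr ↦
    lefschetzPow_surjOn_algebraicClasses_of_hodgeClasses_algebraic hX hη hpr hq (hHC p (by omega))

/-- **`A(X, η)` HOLDS FOR EVERY SMOOTH COMPLEX PROJECTIVE `X` OF DIMENSION `≤ 4` and every polarisation class `η`,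
unconditionally** (no named fact): for `n ≤ 4` there is no codimension `p` with `2 ≤ p` and `2p < n`
(`standardConjectureA_of_surjOn_two_le`). For fourfolds the three instances of clause (b) are `(p, r) = (0, 4)` (hard
Lefschetz on `H⁰`), `(1, 2)` (`L² : N¹ H² ⥲ N³ H⁶`, Lefschetz `(1,1)`) and `(2, 0)` (the identity of `N² H⁴`). Consistent
with the classical status of `D(X)` (`⇔ A(X, L)` in characteristic `0`), known for `dim X ≤ 4` by the work of Kleiman
and Lieberman; the tree had `n ≤ 3` (`standardConjectureA_of_dim_le_three`, via the Hodge conjecture in dimension `≤ 3`).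
[cite: Grothendieck1968, §3 p. 196 (A(X))] [cite: Lieberman1968, Introduction (dim ≤ 4)]
[cite: VoisinHodgeI2002, Thm. 11.30, Thm. 6.25 and §7.1.2] -/
theorem standardConjectureA_of_dim_le_four (hn : n ≤ 4) (hX : IsSmoothProjective n X)
    (hη : IsPolarizationClass n X η) : StandardConjectureA n X η :=
  standardConjectureA_of_surjOn_two_le hX hη fun _ _ _ _ _ _ _ ↦ by omega

/-- **The first dimension with content, `n = 5`**: for `X` a smooth complex projective FIVEFOLD and `η` a polarisation
class, `A(X, η)` is equivalent to the single surjectivity `L_η(N² H⁴(X(ℂ); ℂ)) ⊇ N³ H⁶(X(ℂ); ℂ)` (every algebraic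
`2`-cycle class is `η ∪` an algebraic codimension-`2` class) — the instance `(p, r) = (2, 1)` of clause (b), all others
being unconditional. [cite: Grothendieck1968, §3 p. 196 (A(X))] [cite: VoisinHodgeI2002, Thm. 11.30 and Thm. 6.25] -/
theorem standardConjectureA_five_iff_surjOn (hX : IsSmoothProjective 5 X) (hη : IsPolarizationClass 5 X η) :
    StandardConjectureA 5 X η ↔
      Set.SurjOn (lefschetzPow η 1 (2 * 2)) (algebraicClasses X 2 : Set (complexBetti X (2 * 2)))
        (supportedClasses X (2 * 2 + 2 * 1) (2 + 1)) := by
  refine ⟨fun h ↦ (h.2 2 1 (2 + 1) rfl rfl).surjOn, fun h ↦ ?_⟩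
  refine standardConjectureA_of_surjOn_two_le hX hη fun p r q hp hpr hq hr ↦ ?_
  obtain rfl : p = 2 := by omega
  obtain rfl : r = 1 := by omega
  subst hq
  exact h

end RealCarriers

/-! ## §2 The `A`-ladders of part XIV: rungs `d ≤ 3` fact-free; the first open rung `d = 4` as one surjectivity -/

/-- **`(A∀)_d` HOLDS FOR EVERY `d ≤ 3`, unconditionally and WITHOUT any named fact**: the total space of a compact
pencil of abelian `d`-folds is smooth projective of dimension `d + 1 ≤ 4` (`standardConjectureA_of_dim_le_four`). In
particular the rung `d = 3` (compact pencils of abelian THREEFOLDS, fourfold total spaces) is a theorem in the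
`A`-form, while in the `⋆_L`-form (`LefschetzBCompactPencilsAtRelDim 3`, part VII) it is open, and `d = 2` there rests
on Tankeev 2011 (part X). Supersedes part XIV's `standardACompactPencilsAtRelDim_of_le_two`.
[cite: Grothendieck1968, §3 p. 196 (A(X))] [cite: Andre1996Motifs, §6.3 Remarque 2 (p. 33)] -/
theorem standardACompactPencilsAtRelDim_of_le_three {d : ℕ} (hd : d ≤ 3) : StandardACompactPencilsAtRelDim d :=
  fun _ _ _ hf _ hη ↦ standardConjectureA_of_dim_le_four (by omega) hf.isSmoothProjective_total hη

/-- `(A^CM)_d` holds for every `d ≤ 3`, unconditionally and fact-free. [cite: Grothendieck1968, §3 p. 196 (A(X))] -/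
theorem standardACMPointedPencilsAtRelDim_of_le_three {d : ℕ} (hd : d ≤ 3) : StandardACMPointedPencilsAtRelDim d :=
  standardACMPointedPencilsAtRelDim_of_compact (standardACompactPencilsAtRelDim_of_le_three hd)

/-- The rung `d = 3` by name: `A(𝒳, η)` for every compact pencil of abelian threefolds and every polarisation class of
its (fourfold) total space. [cite: Grothendieck1968, §3 p. 196 (A(X))] -/
theorem standardACompactPencilsAtRelDim_three : StandardACompactPencilsAtRelDim 3 :=
  standardACompactPencilsAtRelDim_of_le_three le_rfl

/-- Hence A_pen∀ is equivalent to its pieces of relative dimension `≥ 4` (sharpens part XIV's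
`compactAbelianPencilStandardA_iff_forall_three_le`). [folklore] -/
theorem compactAbelianPencilStandardA_iff_forall_four_le :
    CompactAbelianPencilStandardA ↔ ∀ d, 4 ≤ d → StandardACompactPencilsAtRelDim d := by
  rw [compactAbelianPencilStandardA_iff_forall]
  refine ⟨fun h d _ ↦ h d, fun h d ↦ ?_⟩
  rcases Nat.lt_or_ge d 4 with hd | hd
  · exact standardACompactPencilsAtRelDim_of_le_three (by omega)
  · exact h d hd

/-- … and A_pen^CM to its pieces of relative dimension `≥ 4` (sharpens part XIV's
`cmPointedPencilStandardA_iff_forall_three_le`). [folklore] -/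
theorem cmPointedPencilStandardA_iff_forall_four_le :
    CMPointedPencilStandardA ↔ ∀ d, 4 ≤ d → StandardACMPointedPencilsAtRelDim d := by
  rw [cmPointedPencilStandardA_iff_forall]
  refine ⟨fun h d _ ↦ h d, fun h d ↦ ?_⟩
  rcases Nat.lt_or_ge d 4 with hd | hd
  · exact standardACMPointedPencilsAtRelDim_of_le_three (by omega)
  · exact h d hd

/-- **THE FIRST OPEN `A`-RUNG, ISOLATED**: `(A∀)_4` — `A(𝒳, η)` on the FIVEFOLD total spaces of the compact pencils of
abelian FOURFOLDS (the relative dimension where Weil-type fibres live) — is equivalent to ONE surjectivity per pencil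
and polarisation class: `L_η(N² H⁴(𝒳(ℂ); ℂ)) ⊇ N³ H⁶(𝒳(ℂ); ℂ)`, i.e. every algebraic `2`-cycle class on `𝒳` is `η ∪`
an algebraic codimension-`2` class (`standardConjectureA_five_iff_surjOn`). OPEN; stated, not proved.
[cite: Grothendieck1968, §3 p. 196 (A(X))] [cite: Andre1996Motifs, §6.3 Remarque 2 (p. 33)] -/
theorem standardACompactPencilsAtRelDim_four_iff_surjOn :
    StandardACompactPencilsAtRelDim 4 ↔
      ∀ ⦃𝒳 S : SchemeOver ℂ⦄ (f : 𝒳 ⟶ S), IsCompactAbelianPencil f 4 →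
        ∀ η : complexBetti 𝒳 2, IsPolarizationClass 5 𝒳 η →
          Set.SurjOn (lefschetzPow η 1 (2 * 2)) (algebraicClasses 𝒳 2 : Set (complexBetti 𝒳 (2 * 2)))
            (supportedClasses 𝒳 (2 * 2 + 2 * 1) (2 + 1)) :=
  ⟨fun h _ _ f hf η hη ↦ (standardConjectureA_five_iff_surjOn hf.isSmoothProjective_total hη).1 (h f hf η hη),
    fun h _ _ f hf η hη ↦ (standardConjectureA_five_iff_surjOn hf.isSmoothProjective_total hη).2 (h f hf η hη)⟩

/-- Summary of the fact-free part of both ladders after this file (C6-style bookkeeping): every `A`-rung `d ≤ 3` in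
both the compact and the CM-pointed form. [folklore] -/
theorem standardARungs_le_three :
    (∀ d, d ≤ 3 → StandardACompactPencilsAtRelDim d) ∧ (∀ d, d ≤ 3 → StandardACMPointedPencilsAtRelDim d) :=
  ⟨fun _ hd ↦ standardACompactPencilsAtRelDim_of_le_three hd,
    fun _ hd ↦ standardACMPointedPencilsAtRelDim_of_le_three hd⟩

end Summit.HodgeConjecture.HodgeConjecture.Ring2.AbelianAll

end
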